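import Literature.Analysis.FluidPDE.PeriodicCylinderNeumannGradient
import HarnessLib

/-!
# Frame inversion near the wall of the cylinder: constant words through the frame `{x_h, J, e₂}`

Topic `Literature/Analysis/FluidPDE`. Infrastructure (all results proved) for the discharge of the
pressure estimate `Literature.Analysis.FluidPDE.Ferrari1993_periodicCylinderPressureEstimate` (Ferrari
1993, Lemma 2; the `H^s` estimate of the Neumann problem (10)–(12), p. 281: near the boundary the
estimate is obtained in adapted coordinates — tangential derivatives and the normal derivative). The
Neumann estimates of the tree control derivatives of `q` along the commuting frame of the cylinder
— `x_h·∇ = r∂_r` (`horizontalProj`), `J = ∂_θ` (`rotGen`), `e₂ = ∂_z` — whereas the Sobolev norm is a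
sum over words of **constant** directions. Away from the axis the frame is invertible: at a point
`x` with `r(x) > 0`, every vector `v` is
`v = (⟪v, x_h⟫/r²) x_h + (⟪v, Jx⟫/r²) Jx + v₂ e₂`, with coefficients `≤ 2‖v‖` for `r ≥ 1/2`.
Iterating this through a word costs commutators of the frame fields with constant fields, which are
constant fields again (`[∂_w, x_h·∇] = ∂_{w_h}`, `[∂_w, J] = ∂_{Jw}`, `[∂_w, ∂₂] = 0`). Result
(`exists_norm_cylWord_const_le_frameSum`): for every `n` there is `C` such that for every word of
`n` constant letters of norm `≤ M` (`M ≥ 1`), every `g` smooth on the closed cylinder and every point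
of the closed cylinder with `r ≥ 1/2`,
`‖∂_{v₁}⋯∂_{v_n} g (x)‖ ≤ C Mⁿ Σ_{m ≤ n} Σ_{om ∈ {x_h, J, e₂}^m} ‖X_om g (x)‖`
(pointwise). Encodings: frame letters `Option Bool` (`none` = `x_h·∇`, `some b` = `tanField b`),
frame words `frameWord om` (innermost letter `om 0`). All statements are folklore calculus.

Mathlib/tree search: the one-step inversions `r²∂₀ = x₀∂_{x_h} − x₁∂_J`, `r²∂₁ = x₁∂_{x_h} + x₀∂_J`
and the commutators are in `PeriodicCylinderWithinCalculus.lean` (`sq_smul_cylDeriv_zero_eq`,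
`cylDeriv_cylBasis_horizontalProj_sub`, `cylDeriv_zero_rotGen_sub`, `cylDeriv_comm_sub`); the word
bookkeeping follows `PeriodicCylinderWordNorms.lean`.
-/

noncomputable section

open MeasureTheory Set Function Filter Topology TopologicalSpace WithLp Metric
open scoped ContDiff NNReal ENNReal InnerProductSpace RealInnerProductSpace

namespace Literature.Analysis.FluidPDE

open Literature.Analysis.FunctionSpaces

/-- Local notation for physical space `ℝ³ = EuclideanSpace ℝ (Fin 3)`. -/
local notation "ℝ³" => EuclideanSpace ℝ (Fin 3)

/-- Local notation for the closed unit cylinder `{r ≤ 1}`. -/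
local notation "𝕂" => closure (SetLike.coe unitCylinder : Set (EuclideanSpace ℝ (Fin 3)))

variable {F : Type*} [NormedAddCommGroup F] [NormedSpace ℝ F]

/-! ### The frame letters and words -/

/-- The frame fields: `none` = `x_h` (`r∂_r`), `some true` = `J` (`∂_θ`), `some false` = `e₂` (`∂_z`).
[folklore] -/
def frameField : Option Bool → (ℝ³ → ℝ³)
  | none => fun y => horizontalProj y
  | some b => tanField b

/-- The word of frame letters of `om : Fin m → Option Bool`, innermost letter `om 0`. [folklore] -/
def frameWord {m : ℕ} (om : Fin m → Option Bool) : List (ℝ³ → ℝ³) :=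
  ((List.ofFn om).reverse).map frameField

/-- The word of constant fields of a list of vectors (head = outermost). [folklore] -/
def constFields (vs : List ℝ³) : List (ℝ³ → ℝ³) := vs.map fun a _ => a

/-- Unfolding `frameField none`. [folklore] -/
@[simp] theorem frameField_none : frameField none = fun y => horizontalProj y := rfl

/-- Unfolding `frameField (some b)`. [folklore] -/
@[simp] theorem frameField_some (b : Bool) : frameField (some b) = tanField b := rfl

/-- The empty frame word. [folklore] -/
@[simp] theorem frameWord_zero (om : Fin 0 → Option Bool) : frameWord om = [] := by simp [frameWord]

/-- One more innermost letter: `frameWord (cons z om) = frameWord om ++ [frameField z]`. [folklore] -/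
theorem frameWord_cons {m : ℕ} (z : Option Bool) (om : Fin m → Option Bool) :
    frameWord (Fin.cons z om : Fin (m + 1) → Option Bool) = frameWord om ++ [frameField z] := by
  simp only [frameWord, List.ofFn_succ, Fin.cons_zero, Fin.cons_succ, List.reverse_cons, List.map_append,
    List.map_cons, List.map_nil]

/-- Unfolding `constFields` on nil. [folklore] -/
@[simp] theorem constFields_nil : constFields [] = [] := rfl

/-- Unfolding `constFields` on a cons. [folklore] -/
@[simp] theorem constFields_cons (a : ℝ³) (vs : List ℝ³) :
    constFields (a :: vs) = (fun _ => a) :: constFields vs := rfl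

/-- The length of `constFields`. [folklore] -/
@[simp] theorem length_constFields (vs : List ℝ³) : (constFields vs).length = vs.length := by
  simp [constFields]

/-- The frame fields are smooth. [folklore] -/
theorem contDiff_frameField : ∀ z : Option Bool, ContDiff ℝ ∞ (frameField z)
  | none => contDiff_horizontalProj
  | some b => contDiff_tanField b

/-- Frame words of smooth functions are smooth on the closed cylinder. [folklore] -/
theorem contDiffOn_cylWord_frameWord {m : ℕ} (om : Fin m → Option Bool) {f : ℝ³ → F}
    (hf : ContDiffOn ℝ ∞ f 𝕂) : ContDiffOn ℝ ∞ (cylWord (frameWord om) f) 𝕂 :=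
  contDiffOn_cylWord (fun V hV => by
    obtain ⟨z, -, rfl⟩ := List.mem_map.1 hV
    exact contDiff_frameField z) hf

/-- Constant words of smooth functions are smooth on the closed cylinder. [folklore] -/
theorem contDiffOn_cylWord_constFields (vs : List ℝ³) {f : ℝ³ → F} (hf : ContDiffOn ℝ ∞ f 𝕂) :
    ContDiffOn ℝ ∞ (cylWord (constFields vs) f) 𝕂 :=
  contDiffOn_cylWord (fun V hV => by
    obtain ⟨a, -, rfl⟩ := List.mem_map.1 hV
    exact contDiff_const) hf

/-! ### Commutators of the frame fields with constant fields -/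

/-- **`∂_Z ∂_w f = ∂_w ∂_Z f − ∂_{c(w)} f`** on the closed cylinder for a frame field `Z` and a constant
field `w`, with `c(w) = w_h` for `Z = x_h·∇`, `c(w) = Jw` for `Z = J`, `c(w) = 0` for `Z = e₂`.
[folklore] -/
theorem cylDeriv_frameField_const (w : ℝ³) : ∀ (z : Option Bool) {f : ℝ³ → F}, ContDiffOn ℝ ∞ f 𝕂 →
    ∀ {x : ℝ³}, x ∈ 𝕂 →
      cylDeriv (frameField z) (cylDeriv (fun _ => w) f) x =
        cylDeriv (fun _ => w) (cylDeriv (frameField z) f) x -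
          cylDeriv (fun _ => Option.elim z (horizontalProj w) (fun b => bif b then rotGen w else 0)) f x
  | none, f, hf, x, hx => by
    have h := cylDeriv_comm_sub (V := fun _ => w) (W := fun y => horizontalProj y) (differentiableAt_const w)
      horizontalProjL.differentiableAt hf hx
    have hfield : (fun y : ℝ³ => fderiv ℝ (fun y => horizontalProj y) y w - fderiv ℝ (fun _ : ℝ³ => w) y (horizontalProj y)) =
        fun _ => horizontalProj w := by
      funext y
      rw [fderiv_horizontalProj, fderiv_fun_const]
      simp
    rw [hfield] at h
    simp only [frameField_none, Option.elim_none]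
    rw [← h]
    abel
  | some true, f, hf, x, hx => by
    have h := cylDeriv_comm_sub (V := fun _ => w) (W := rotGen) (differentiableAt_const w)
      (hasFDerivAt_rotGen x).differentiableAt hf hx
    have hfield : (fun y : ℝ³ => fderiv ℝ rotGen y w - fderiv ℝ (fun _ : ℝ³ => w) y (rotGen y)) =
        fun _ => rotGen w := by
      funext y
      rw [fderiv_rotGen, fderiv_fun_const]
      simp
    rw [hfield] at h
    simp only [frameField_some, Option.elim_some, cond_true]
    show cylDeriv (tanField true) (cylDeriv (fun _ => w) f) x = _
    simp only [tanField]
    rw [← h]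
    abel
  | some false, f, hf, x, hx => by
    simp only [frameField_some, Option.elim_some, cond_false]
    show cylDeriv (tanField false) (cylDeriv (fun _ => w) f) x = _
    simp only [tanField]
    have h0 : cylDeriv (fun _ : ℝ³ => (0 : ℝ³)) f x = 0 := by simp [cylDeriv_apply]
    rw [h0, sub_zero]
    exact (cylDeriv_const_comm w (cylBasis 2) hf hx).symm

/-- **A frame field pushed inside a word of constants**: on the closed cylinder,
`∂_Z (∂_{v₁}⋯∂_{v_n} g) = ∂_{v₁}⋯∂_{v_n} (∂_Z g) − Σᵢ ∂_{v₁}⋯∂_{c(vᵢ)}⋯∂_{v_n} g`. [folklore] -/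
theorem cylDeriv_frameField_cylWord_constFields (z : Option Bool) : ∀ (vs : List ℝ³) {g : ℝ³ → F},
    ContDiffOn ℝ ∞ g 𝕂 →
      EqOn (cylDeriv (frameField z) (cylWord (constFields vs) g))
        (fun x => cylWord (constFields vs) (cylDeriv (frameField z) g) x -
          ∑ i ∈ Finset.range vs.length,
            cylWord (constFields (vs.set i (Option.elim z (horizontalProj (vs.getD i 0))
              (fun b => bif b then rotGen (vs.getD i 0) else 0)))) g x) 𝕂
  | [], g, _ => by
    intro x _
    simp
  | v :: vs, g, hg => by
    intro x hx
    have hW : ContDiffOn ℝ ∞ (cylWord (constFields vs) g) 𝕂 := contDiffOn_cylWord_constFields vs hg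
    have hZg : ContDiffOn ℝ ∞ (cylDeriv (frameField z) g) 𝕂 := contDiffOn_cylDeriv (contDiff_frameField z) hg
    rw [constFields_cons, cylWord_cons, cylDeriv_frameField_const v z hW hx]
    have ih := cylDeriv_frameField_cylWord_constFields z vs hg
    rw [cylDeriv_congr ih hx]
    have hterm : ∀ i ∈ Finset.range vs.length, ContDiffOn ℝ ∞ (fun y =>
        cylWord (constFields (vs.set i (Option.elim z (horizontalProj (vs.getD i 0))
          (fun b => bif b then rotGen (vs.getD i 0) else 0)))) g y) 𝕂 := fun i _ =>
      contDiffOn_cylWord_constFields _ hg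
    have hA : ContDiffOn ℝ ∞ (cylWord (constFields vs) (cylDeriv (frameField z) g)) 𝕂 :=
      contDiffOn_cylWord_constFields vs hZg
    have hS : ContDiffOn ℝ ∞ (fun y => ∑ i ∈ Finset.range vs.length,
        cylWord (constFields (vs.set i (Option.elim z (horizontalProj (vs.getD i 0))
          (fun b => bif b then rotGen (vs.getD i 0) else 0)))) g y) 𝕂 := ContDiffOn.sum hterm
    rw [cylDeriv_sub hA hS hx, cylDeriv_finset_sum (Finset.range vs.length) hterm hx]
    simp only [List.length_cons, Finset.sum_range_succ', List.getD_cons_zero, List.getD_cons_succ,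
      List.set_cons_zero, List.set_cons_succ, constFields_cons, cylWord_cons]
    abel

/-! ### The pointwise inversion of one letter -/

/-- **The frame decomposition of a vector away from the axis**:
`v = (⟪v, x_h⟫/r²) x_h + (⟪v, Jx⟫/r²) Jx + v₂ e₂` for `r(x) ≠ 0`. [folklore] -/
theorem eq_frame_decomposition (v : ℝ³) {x : ℝ³} (hx : cylRadius x ≠ 0) :
    v = (⟪v, horizontalProj x⟫ / cylRadius x ^ 2) • horizontalProj x +
      (⟪v, rotGen x⟫ / cylRadius x ^ 2) • rotGen x + v 2 • cylBasis 2 := by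
  have hr2 : cylRadius x ^ 2 = x 0 ^ 2 + x 1 ^ 2 := cylRadius_sq x
  have hr0 : x 0 ^ 2 + x 1 ^ 2 ≠ 0 := by rw [← hr2]; exact pow_ne_zero 2 hx
  have hh : ⟪v, horizontalProj x⟫ = v 0 * x 0 + v 1 * x 1 := by
    rw [horizontalProj_eq_add_cylBasis, inner_add_right, inner_smul_right, inner_smul_right,
      inner_cylBasis_right, inner_cylBasis_right]; ring
  have hJ : ⟪v, rotGen x⟫ = x 0 * v 1 - x 1 * v 0 := by rw [real_inner_comm, inner_rotGen_left]
  rw [hh, hJ, hr2]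
  ext i
  fin_cases i
  · simp [horizontalProj_apply_eq, rotGen, cylBasis_apply]
    field_simp
    ring
  · simp [horizontalProj_apply_eq, rotGen, cylBasis_apply]
    field_simp
    ring
  · simp [horizontalProj_apply_eq, rotGen, cylBasis_apply]

/-- **One constant derivative through the frame, pointwise**: for `r(x) ≠ 0`,
`∂_v G (x) = (⟪v, x_h⟫/r²) ∂_{x_h} G (x) + (⟪v, Jx⟫/r²) ∂_J G (x) + v₂ ∂₂ G (x)`. [folklore] -/
theorem cylDeriv_const_eq_frame (v : ℝ³) (G : ℝ³ → F) {x : ℝ³} (hx : cylRadius x ≠ 0) :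
    cylDeriv (fun _ => v) G x =
      (⟪v, horizontalProj x⟫ / cylRadius x ^ 2) • cylDeriv (fun y => horizontalProj y) G x +
        (⟪v, rotGen x⟫ / cylRadius x ^ 2) • cylDeriv rotGen G x + v 2 • cylDeriv (fun _ => cylBasis 2) G x := by
  simp only [cylDeriv_apply]
  conv_lhs => rw [eq_frame_decomposition v hx]
  simp only [map_add, map_smul]

/-- The coefficients are at most `2‖v‖` where `r ≥ 1/2` (and `r ≤ 1`). [folklore] -/
theorem frame_coeff_le {v x : ℝ³} (hx : x ∈ 𝕂) (hr : 1 / 2 ≤ cylRadius x) :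
    |⟪v, horizontalProj x⟫ / cylRadius x ^ 2| ≤ 2 * ‖v‖ ∧ |⟪v, rotGen x⟫ / cylRadius x ^ 2| ≤ 2 * ‖v‖ ∧
      |v 2| ≤ ‖v‖ := by
  have hr0 : 0 < cylRadius x := lt_of_lt_of_le (by norm_num) hr
  have hr1 : cylRadius x ≤ 1 := by rw [closure_unitCylinder] at hx; exact hx
  have key : ∀ w : ℝ³, ‖w‖ ≤ cylRadius x → |⟪v, w⟫ / cylRadius x ^ 2| ≤ 2 * ‖v‖ := by
    intro w hw
    rw [abs_div, abs_of_pos (pow_pos hr0 2), div_le_iff₀ (pow_pos hr0 2)]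
    calc |⟪v, w⟫| ≤ ‖v‖ * ‖w‖ := abs_real_inner_le_norm v w
      _ ≤ ‖v‖ * cylRadius x := mul_le_mul_of_nonneg_left hw (norm_nonneg _)
      _ ≤ 2 * ‖v‖ * cylRadius x ^ 2 := by
          have h2 : (0 : ℝ) ≤ ‖v‖ * cylRadius x * (2 * cylRadius x - 1) :=
            mul_nonneg (mul_nonneg (norm_nonneg v) hr0.le) (by linarith)
          nlinarith [h2]
  refine ⟨key _ (le_of_eq (norm_horizontalProj x)), key _ (le_of_eq (norm_rotGen_eq_cylRadius x)), ?_⟩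
  simpa using PiLp.norm_apply_le v 2

/-! ### The norms of the commutator vectors -/

/-- `r(w) ≤ ‖w‖`. [folklore] -/
theorem cylRadius_le_norm (w : ℝ³) : cylRadius w ≤ ‖w‖ := by
  rw [cylRadius, EuclideanSpace.norm_eq, Fin.sum_univ_three]
  refine Real.sqrt_le_sqrt ?_
  simp only [Real.norm_eq_abs, sq_abs]
  nlinarith [sq_nonneg (w 2)]

/-- The commutator vector `c(w)` of a frame letter has norm `≤ ‖w‖`. [folklore] -/
theorem norm_frameComm_le (z : Option Bool) (w : ℝ³) :
    ‖Option.elim z (horizontalProj w) (fun b => bif b then rotGen w else 0)‖ ≤ ‖w‖ := by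
  rcases z with _ | _ | _
  · simp only [Option.elim_none, norm_horizontalProj]
    exact cylRadius_le_norm w
  · simp only [Option.elim_some, cond_false, norm_zero]
    exact norm_nonneg w
  · simp only [Option.elim_some, cond_true, norm_rotGen_eq_cylRadius]
    exact cylRadius_le_norm w

/-! ### The main pointwise bound -/

/-- One more innermost frame letter is one more letter of the frame word. [folklore] -/
theorem cylWord_frameWord_cylDeriv {m : ℕ} (om : Fin m → Option Bool) (z : Option Bool) (g : ℝ³ → F) :
    cylWord (frameWord om) (cylDeriv (frameField z) g) =
      cylWord (frameWord (Fin.cons z om : Fin (m + 1) → Option Bool)) g := by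
  rw [frameWord_cons, cylWord_append]
  rfl

/-- **Constant words through the frame, pointwise near the wall.** For `M ≥ 1` and every `n` there is
`C ≥ 0` such that for every word of `n` constant letters `v₁, …, v_n` with `‖vᵢ‖ ≤ M`, every `g` smooth
on the closed cylinder and every point `x` of the closed cylinder with `r(x) ≥ 1/2`,
`‖∂_{v₁}⋯∂_{v_n} g (x)‖ ≤ C Mⁿ Σ_{m ≤ n} Σ_{ω : Fin m → {x_h, J, e₂}} ‖X_ω g (x)‖`.
Induction on the word: the outermost letter is inverted pointwise (`cylDeriv_const_eq_frame`,
coefficients `≤ 2‖v‖` by `frame_coeff_le`), the frame letter is pushed inside the remaining constant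
word (`cylDeriv_frameField_cylWord_constFields`; the commutator words have constant letters of norm
`≤ M` again, `norm_frameComm_le`), and the induction hypothesis is applied to `∂_Z g` and to `g`;
`C_{n+1} = 5(n+1)C_n`. [folklore] -/
theorem exists_norm_cylWord_constFields_le_frameSum {M : ℝ} (hM1 : 1 ≤ M) :
    ∀ n : ℕ, ∃ C : ℝ, 0 ≤ C ∧ ∀ (vs : List ℝ³), vs.length = n → (∀ v ∈ vs, ‖v‖ ≤ M) →
      ∀ (g : ℝ³ → F), ContDiffOn ℝ ∞ g 𝕂 → ∀ {x : ℝ³}, x ∈ 𝕂 → 1 / 2 ≤ cylRadius x →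
        ‖cylWord (constFields vs) g x‖ ≤
          C * M ^ n * ∑ m ∈ Finset.range (n + 1), ∑ om : Fin m → Option Bool,
            ‖cylWord (frameWord om) g x‖ := by
  have hM0 : 0 ≤ M := zero_le_one.trans hM1
  -- the frame sum and its monotonicity
  set Psum : ℕ → (ℝ³ → F) → ℝ³ → ℝ := fun n g x => ∑ m ∈ Finset.range (n + 1), ∑ om : Fin m → Option Bool,
    ‖cylWord (frameWord om) g x‖ with hPsum
  have hPsum0 : ∀ n g x, 0 ≤ Psum n g x := fun n g x =>
    Finset.sum_nonneg fun m _ => Finset.sum_nonneg fun om _ => norm_nonneg _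
  have hPsummono : ∀ n g x, Psum n g x ≤ Psum (n + 1) g x := fun n g x => by
    simp only [hPsum]
    rw [Finset.sum_range_succ _ (n + 1)]
    exact le_add_of_nonneg_right (Finset.sum_nonneg fun om _ => norm_nonneg _)
  have hPsumderiv : ∀ n g x (z : Option Bool), Psum n (cylDeriv (frameField z) g) x ≤ Psum (n + 1) g x := by
    intro n g x z
    simp only [hPsum]
    calc ∑ m ∈ Finset.range (n + 1), ∑ om : Fin m → Option Bool,
          ‖cylWord (frameWord om) (cylDeriv (frameField z) g) x‖
        = ∑ m ∈ Finset.range (n + 1), ∑ om : Fin m → Option Bool,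
            ‖cylWord (frameWord (Fin.cons z om : Fin (m + 1) → Option Bool)) g x‖ := by
          simp only [cylWord_frameWord_cylDeriv]
      _ ≤ ∑ m ∈ Finset.range (n + 1), ∑ om' : Fin (m + 1) → Option Bool, ‖cylWord (frameWord om') g x‖ := by
          refine Finset.sum_le_sum fun m _ => ?_
          rw [sum_fin_succ_fun]
          exact Finset.single_le_sum (f := fun z' : Option Bool => ∑ om : Fin m → Option Bool,
            ‖cylWord (frameWord (Fin.cons z' om : Fin (m + 1) → Option Bool)) g x‖)
            (fun _ _ => Finset.sum_nonneg fun om _ => norm_nonneg _) (Finset.mem_univ z)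
      _ ≤ ∑ m ∈ Finset.range (n + 1 + 1), ∑ om : Fin m → Option Bool, ‖cylWord (frameWord om) g x‖ := by
          rw [Finset.sum_range_succ' _ (n + 1)]
          exact le_add_of_nonneg_right (Finset.sum_nonneg fun om _ => norm_nonneg _)
  intro n
  induction n with
  | zero =>
    refine ⟨1, zero_le_one, fun vs hvs _ g _ x _ _ => ?_⟩
    have hnil : vs = [] := List.eq_nil_of_length_eq_zero hvs
    subst hnil
    simp only [constFields_nil, cylWord_nil, pow_zero, one_mul, zero_add, Finset.range_one,
      Finset.sum_singleton]
    rw [sum_fin_zero_fun, frameWord_zero, cylWord_nil]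
  | succ n ih =>
    obtain ⟨C, hC0, hC⟩ := ih
    refine ⟨5 * (n + 1) * C, by positivity, fun vs hvs hletters g hg x hx hr => ?_⟩
    obtain ⟨v, vs', rfl⟩ := List.exists_of_length_succ vs hvs
    have hvs' : vs'.length = n := by simpa using hvs
    have hv : ‖v‖ ≤ M := hletters v (List.mem_cons_self ..)
    have hletters' : ∀ w ∈ vs', ‖w‖ ≤ M := fun w hw => hletters w (List.mem_cons_of_mem _ hw)
    have hr0 : cylRadius x ≠ 0 := (lt_of_lt_of_le (by norm_num) hr).ne'
    set G : ℝ³ → F := cylWord (constFields vs') g with hG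
    have hGs : ContDiffOn ℝ ∞ G 𝕂 := contDiffOn_cylWord_constFields vs' hg
    -- the bound for one frame letter applied to the inner word
    have hZ : ∀ z : Option Bool, ‖cylDeriv (frameField z) G x‖ ≤ (n + 1) * C * M ^ n * Psum (n + 1) g x := by
      intro z
      have hid := cylDeriv_frameField_cylWord_constFields (F := F) z vs' hg hx
      rw [hG, hid]
      -- main term
      have hmain : ‖cylWord (constFields vs') (cylDeriv (frameField z) g) x‖ ≤ C * M ^ n * Psum (n + 1) g x := by
        have h := hC vs' hvs' hletters' (cylDeriv (frameField z) g)
          (contDiffOn_cylDeriv (contDiff_frameField z) hg) hx hr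
        exact h.trans (mul_le_mul_of_nonneg_left (hPsumderiv n g x z) (by positivity))
      -- commutator terms
      have hcomm : ∀ i ∈ Finset.range vs'.length,
          ‖cylWord (constFields (vs'.set i (Option.elim z (horizontalProj (vs'.getD i 0))
            (fun b => bif b then rotGen (vs'.getD i 0) else 0)))) g x‖ ≤ C * M ^ n * Psum (n + 1) g x := by
        intro i hi
        have hi' : i < vs'.length := Finset.mem_range.1 hi
        have hmem : vs'.getD i 0 ∈ vs' := by
          rw [List.getD_eq_getElem _ _ hi']
          exact List.getElem_mem hi'
        have hlen : (vs'.set i (Option.elim z (horizontalProj (vs'.getD i 0))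
            (fun b => bif b then rotGen (vs'.getD i 0) else 0))).length = n := by
          rw [List.length_set, hvs']
        have hlet : ∀ w ∈ vs'.set i (Option.elim z (horizontalProj (vs'.getD i 0))
            (fun b => bif b then rotGen (vs'.getD i 0) else 0)), ‖w‖ ≤ M := by
          intro w hw
          rcases List.mem_or_eq_of_mem_set hw with h | h
          · exact hletters' w h
          · rw [h]
            exact (norm_frameComm_le z _).trans (hletters' _ hmem)
        have h := hC _ hlen hlet g hg hx hr
        exact h.trans (mul_le_mul_of_nonneg_left (hPsummono n g x) (by positivity))
      calc _ ≤ ‖cylWord (constFields vs') (cylDeriv (frameField z) g) x‖ +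
            ‖∑ i ∈ Finset.range vs'.length,
              cylWord (constFields (vs'.set i (Option.elim z (horizontalProj (vs'.getD i 0))
                (fun b => bif b then rotGen (vs'.getD i 0) else 0)))) g x‖ := norm_sub_le _ _
        _ ≤ C * M ^ n * Psum (n + 1) g x + ∑ i ∈ Finset.range vs'.length, C * M ^ n * Psum (n + 1) g x :=
            add_le_add hmain ((norm_sum_le _ _).trans (Finset.sum_le_sum hcomm))
        _ = (n + 1) * C * M ^ n * Psum (n + 1) g x := by
            rw [Finset.sum_const, Finset.card_range, hvs', nsmul_eq_mul]
            ring
    -- the outermost letter through the frame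
    obtain ⟨hα, hβ, hγ⟩ := frame_coeff_le (v := v) hx hr
    have hB : 0 ≤ (n + 1) * C * M ^ n * Psum (n + 1) g x := by
      have := hPsum0 (n + 1) g x
      positivity
    rw [constFields_cons, cylWord_cons, cylDeriv_const_eq_frame v G hr0]
    calc ‖(⟪v, horizontalProj x⟫ / cylRadius x ^ 2) • cylDeriv (fun y => horizontalProj y) G x +
          (⟪v, rotGen x⟫ / cylRadius x ^ 2) • cylDeriv rotGen G x + v 2 • cylDeriv (fun _ => cylBasis 2) G x‖
        ≤ ‖(⟪v, horizontalProj x⟫ / cylRadius x ^ 2) • cylDeriv (fun y => horizontalProj y) G x‖ +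
          ‖(⟪v, rotGen x⟫ / cylRadius x ^ 2) • cylDeriv rotGen G x‖ + ‖v 2 • cylDeriv (fun _ => cylBasis 2) G x‖ :=
          norm_add₃_le
      _ = |⟪v, horizontalProj x⟫ / cylRadius x ^ 2| * ‖cylDeriv (frameField none) G x‖ +
          |⟪v, rotGen x⟫ / cylRadius x ^ 2| * ‖cylDeriv (frameField (some true)) G x‖ +
          |v 2| * ‖cylDeriv (frameField (some false)) G x‖ := by
          simp only [norm_smul, Real.norm_eq_abs]
          rfl
      _ ≤ 2 * ‖v‖ * ((n + 1) * C * M ^ n * Psum (n + 1) g x) + 2 * ‖v‖ * ((n + 1) * C * M ^ n * Psum (n + 1) g x) +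
          ‖v‖ * ((n + 1) * C * M ^ n * Psum (n + 1) g x) := by
          gcongr
          · exact hZ none
          · exact hZ (some true)
          · exact hZ (some false)
      _ = 5 * ‖v‖ * ((n + 1) * C * M ^ n * Psum (n + 1) g x) := by ring
      _ ≤ 5 * M * ((n + 1) * C * M ^ n * Psum (n + 1) g x) := by gcongr
      _ = 5 * (n + 1) * C * M ^ (n + 1) * Psum (n + 1) g x := by ring

end Literature.Analysis.FluidPDE
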